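import Mathlib.Analysis.InnerProductSpace.Dual
import Literature.Geometry.Lorentzian.MassCapacitySchwarzschild
import Literature.Geometry.Lorentzian.MassCapacityHarmonic
import Literature.Geometry.Lorentzian.EndChartIntegral
import Literature.Geometry.Lorentzian.AFEndChartEmbedding
import HarnessLib

/-!
# The capacity of the horizon of an end isometric to the Schwarzschild exterior is `2m`
# (Bray 2001, §6, Thm. 9, case of equality; Def. 17 with (86)–(87) and (12))

`MassCapacitySchwarzschild.lean` computes the capacity `ℰ(Σ, g)` of Def. 17
(`horizonCapacity`, `MassCapacity.lean`) for the **model**: the horizon `r = m/2` of the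
time-symmetric Schwarzschild slice `(ℝ³ ∖ {0}, (1 + m/2r)⁴ δ)` in its tautological end
structure has `ℰ = 2m`. The conclusion of the rigidity statements of the tree, however, is an
*isometry of an exterior region `U ⊆ X` of an abstract data manifold with the Schwarzschild
exterior* (`Bray2001_penrose_rigidity_exteriorRegion`, `Bray2001_capacity_rigidity`), i.e. an
end structure `e : AFEnd X` on `U = e.U` (`AFEnd`: an open set `U`, a radius `R`, a
diffeomorphism `U ≅ {R < ‖z‖}`, closed at infinity) in whose chart the metric has the
Schwarzschild components `h_{ij}(z) = (1 + R/‖z‖)⁴ δ_{ij}` — the horizon `r = R = m/2` being the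
ideal boundary `∂U` of the chart. This file proves the capacity computation in that generality:

* `AFEnd.horizonCapacity_eq_of_hCoeff_eq_schwarzschild` — **main theorem**: if the chart
  components of `h` on the end `e` are `(1 + R/‖z‖)⁴ δ_{ij}` for `‖z‖ > R = e.R` and `U = e.U` is
  an exterior region of `e` (`IsExteriorRegion`: connected, compact modulo the end — so that the
  horizon is present in `X` as `∂U`), then `horizonCapacity D.h e e.U = ENNReal.ofReal (4R)`,
  i.e. `ℰ(∂U, h) = 2m` for `m = 2R`; `…_toReal_div_two` is the form `ℰ/2 = m` of
  `Bray2001_capacity_eq_of_penrose_eq`.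

The two bounds are those of the model file, transported through the chart of the end:

* *Lower bound* `AFEnd.le_dirichletEnergy_of_hCoeff_eq_schwarzschild`: for a test function `φ`
  (continuous on `X`, smooth on `U`, `0` off `U`, `→ 1` at infinity), `F = endValue e φ = φ ∘ Φ`
  (extended by `0` inside the ball) is continuous at the coordinate sphere `‖z‖ = R`
  (`AFEnd.continuousAt_endValue_of_norm_eq`: points of `U` with coordinates accumulating at the
  sphere accumulate in `X` only at `∂U`, by compactness modulo the end), `C¹` on the shell and
  `→ 1` at infinity, so `∫_X |∇φ|² dV_h ≥ ∫_U |∇φ|² dV_h = ∫_{‖z‖ > R} ψ² ‖∇F‖² dz ≥ 8πR`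
  (`SchwarzschildCapacity.le_lintegral_shell_conformalGradSq`; chart formulas
  `AFEnd.setLIntegral_far`, `AFEnd.innerDual_mvfderiv_dataChart`, with `√(det h_{ij}) = ψ⁶` and
  `h^{ij} = ψ⁻⁴ δ^{ij}`).
* *Upper bound*: Bray's Green's function `φ₀ = (r - R)/(r + R)` read through the global
  coordinate function `e.coord` (`AFEnd.isCapacityTestFn_greenProfile_coord`: it is continuous
  across `∂U` because near a point off the end the coordinates of end points are close to the
  sphere, `AFEnd.eventually_norm_coord_lt`, the end being closed at infinity) has
  `∫_U |∇φ₀|² dV_h ≤ 8πR` (`SchwarzschildCapacity.lintegral_shell_profile_le`), and the capacity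
  is at most `(1/2π) ∫_U |∇φ₀|²` for every test function with `0 < φ₀ < 1` on `U` of finite
  energy over `U` (`horizonCapacity_le_setLIntegral_of_isCapacityTestFn`, by the smooth double
  truncations `W_n ∘ φ₀` of `MassCapacityHarmonic.lean`, which are supported inside `U`, and
  dominated convergence) — so that neither the measure of `∂U` nor the behaviour of `∇φ₀` at
  `∂U` enters.

Everything is proved; no definitions and no named facts are introduced.

## References

* H. L. Bray, *Proof of the Riemannian Penrose inequality using the positive mass theorem*,
  J. Differential Geom. 59 (2001) 177–267 (arXiv:math/9911173): §1 (12) (the Schwarzschild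
  slice); §6, Def. 17 (85), the Green's function (86)–(87), Thm. 9 (case of equality).
  (key `BrayRPI2001`)
* R. Bartnik, *The mass of an asymptotically flat manifold*, CPAM 39 (1986), §1 (structures of
  infinity; the chart of an end). (key `Bartnik1986`)
* H. Federer, *Geometric Measure Theory*, Springer 1969, §3.2.46 (Riemannian measure in a chart).
-/

noncomputable section

open Set Filter Function MeasureTheory Metric Topology TopologicalSpace Manifold Bundle Bornology
open scoped ENNReal Topology Real Manifold ContDiff InnerProductSpace

namespace Literature.Geometry.Lorentzian

open PseudoRiemannianMetric SchwarzschildCapacity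

/-! ### Euclidean preliminaries -/

/-- For a continuous linear functional `L` on `ℝ³`, `∑ₖ L(eₖ)² = ‖L‖²` (Parseval for the Riesz
representative). [folklore] -/
theorem sum_sq_apply_single_eq_norm_sq (L : E3 →L[ℝ] ℝ) :
    ∑ k : Fin 3, L (EuclideanSpace.single k 1) ^ 2 = ‖L‖ ^ 2 := by
  set v : E3 := (InnerProductSpace.toDual ℝ E3).symm L with hv
  have hL : ∀ w, L w = ⟪v, w⟫_ℝ := fun w ↦ by
    rw [hv, InnerProductSpace.toDual_symm_apply]
  have hnorm : ‖L‖ = ‖v‖ := by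
    rw [hv]
    exact ((InnerProductSpace.toDual ℝ E3).symm.norm_map L).symm
  rw [hnorm, EuclideanSpace.norm_sq_eq]
  refine Finset.sum_congr rfl fun k _ ↦ ?_
  rw [hL, EuclideanSpace.inner_single_right, Real.norm_eq_abs, sq_abs]
  simp

/-- The inverse of the scalar matrix `c • 1` is `c⁻¹ • 1` (`c ≠ 0`). [folklore] -/
theorem Matrix.inv_smul_one_fin {n : ℕ} {c : ℝ} (hc : c ≠ 0) :
    (c • (1 : Matrix (Fin n) (Fin n) ℝ))⁻¹ = c⁻¹ • (1 : Matrix (Fin n) (Fin n) ℝ) :=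
  Matrix.inv_eq_right_inv (by rw [Matrix.smul_mul, Matrix.one_mul, smul_smul, mul_inv_cancel₀ hc,
    one_smul])

namespace AFEnd

variable {X : Type} [TopologicalSpace X] [ChartedSpace E3 X]

/-! ### The end in its chart: the whole end as a far region, points off the end -/

section Topology

variable (e : AFEnd X)

/-- The far region of radius `R` (the inner radius) is the whole end `U`. [folklore] -/
theorem far_radius_eq : e.far e.R = (e.U : Set X) := by
  refine subset_antisymm (e.far_subset _) fun q hq ↦ ?_
  exact e.mem_far_iff_coord.2 ⟨hq, e.lt_norm_coord hq⟩

/-- **Near a point off the end, end points have coordinates close to the sphere**: if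
`x ∉ U` and `R < R'`, then every `y ∈ U` near `x` has `‖coord y‖ < R'` (the closed far piece
`{y ∈ U | R' ≤ ‖coord y‖}` is closed in `X`, the end being closed at infinity, and misses `x`).
[cite: Bartnik1986, §1] -/
theorem eventually_norm_coord_lt {x : X} (hx : x ∉ e.U) {R' : ℝ} (hR' : e.R < R') :
    ∀ᶠ y in 𝓝 x, y ∈ e.U → ‖e.coord y‖ < R' := by
  have hxc : x ∉ ((↑) : e.U → X) '' (e.chart ⁻¹' {z | R' ≤ ‖(z : E3)‖}) := fun h ↦ by
    obtain ⟨hxU, -⟩ := e.mem_image_preimage_le_norm_iff.1 h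
    exact hx hxU
  filter_upwards [(e.isClosed_far R' hR').isOpen_compl.mem_nhds hxc] with y hy hyU
  by_contra hle
  exact hy (e.mem_image_preimage_le_norm_iff.2 ⟨hyU, not_lt.1 hle⟩)

/-- A point of the end read back through the chart: `dataChart ⟨coord q, _⟩ = q`, in the form
`dataChartExt (coord q) = q`. Deprecated alias of `AFEnd.dataChartExt_coord_of_mem`
(`AFEndChartEmbedding.lean`, the light-import home of this fact; librarian merge 2026-08-17).
[folklore] -/
@[deprecated AFEnd.dataChartExt_coord_of_mem (since := "2026-08-17")]
alias dataChartExt_coord := dataChartExt_coord_of_mem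

/-- **Functions vanishing off an exterior end, read in the chart, are continuous at the
coordinate sphere.** Let `U = e.U` be compact modulo the end (`IsExteriorRegion e e.U`) and let
`φ : X → ℝ` be continuous and vanish off `U`. Then `endValue e φ` (`= φ ∘ Φ` outside the ball
`‖z‖ ≤ R`, `= 0` inside) is continuous at every `z₀` with `‖z₀‖ = R`: for `ε > 0` the set
`{ε ≤ |φ|} ∖ far (R + 1)` is a compact subset of `U`, so its coordinates form a compact subset
of `{R < ‖z‖}`, away from `z₀`. (This is how the horizon `∂U`, on which test functions vanish,
appears in the chart as the sphere `‖z‖ = R`.) [cite: BrayRPI2001, §6 Def. 17] -/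
theorem continuousAt_endValue_of_norm_eq (hU : IsExteriorRegion e e.U) {φ : X → ℝ}
    (hφc : Continuous φ) (hφ0 : ∀ x, x ∉ (e.U : Set X) → φ x = 0) {z₀ : E3}
    (hz₀ : ‖z₀‖ = e.R) : ContinuousAt (endValue e φ) z₀ := by
  have hF0 : endValue e φ z₀ = 0 := endValue_of_not_lt e φ (by rw [hz₀]; exact lt_irrefl _)
  rw [ContinuousAt, hF0, Metric.tendsto_nhds]
  intro ε hε
  -- the compact set `{ε ≤ |φ|} ∖ far (R + 1) ⊆ U` and its coordinates
  set A : Set X := {x | ε ≤ |φ x|} \ e.far (e.R + 1) with hA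
  have hAU : A ⊆ (e.U : Set X) := fun x hx ↦ by
    by_contra hxU
    have h0 := hφ0 x hxU
    have : ε ≤ |φ x| := hx.1
    rw [h0, abs_zero] at this
    exact absurd this (not_le.2 hε)
  have hAc : IsCompact A := by
    refine (hU.isCompact_closure_diff_far (e.R + 1)).of_isClosed_subset ?_ fun x hx ↦
      ⟨subset_closure (hAU hx), hx.2⟩
    exact (isClosed_le continuous_const (continuous_abs.comp hφc)).sdiff (e.isOpen_far _)
  set K : Set E3 := e.coord '' A with hK
  have hKc : IsCompact K := by
    refine hAc.image_of_continuousOn fun x hx ↦ ?_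
    exact (e.contMDiffAt_coord (hAU hx)).continuousAt.continuousWithinAt
  have hz₀K : z₀ ∉ K := by
    rintro ⟨x, hx, hxz⟩
    have h1 := e.lt_norm_coord (hAU hx)
    rw [hxz, hz₀] at h1
    exact lt_irrefl _ h1
  -- on the neighbourhood `Kᶜ ∩ {‖z‖ < R + 1}` of `z₀`, `|endValue e φ| < ε`
  have hN : Kᶜ ∩ {z : E3 | ‖z‖ < e.R + 1} ∈ 𝓝 z₀ := by
    refine Filter.inter_mem (hKc.isClosed.isOpen_compl.mem_nhds hz₀K)
      ((isOpen_lt continuous_norm continuous_const).mem_nhds ?_)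
    show ‖z₀‖ < e.R + 1
    rw [hz₀]; linarith
  filter_upwards [hN] with z hz
  rw [Real.dist_eq, sub_zero]
  by_contra hge
  replace hge : ε ≤ |endValue e φ z| := not_lt.1 hge
  by_cases hzR : e.R < ‖z‖
  · rw [endValue_of_lt e φ hzR] at hge
    set x := e.dataChart ⟨z, hzR⟩ with hx
    have hxU : x ∈ e.U := e.dataChart_mem ⟨z, hzR⟩
    have hcx : e.coord x = z := e.coord_dataChart ⟨z, hzR⟩
    have hxfar : x ∉ e.far (e.R + 1) := fun h' ↦ by
      obtain ⟨-, h''⟩ := e.mem_far_iff_coord.1 h'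
      rw [hcx] at h''
      exact absurd h'' (not_lt.2 hz.2.le)
    exact hz.1 ⟨x, ⟨hge, hxfar⟩, hcx⟩
  · rw [endValue_of_not_lt e φ hzR, abs_zero] at hge
    exact absurd hge (not_le.2 hε)

end Topology

/-! ### Test functions read in the chart: smoothness on the shell -/

section Chart

variable (e : AFEnd X)

/-- A function smooth on the end, read in the chart, is smooth on the shell `{R < ‖z‖}`: if
`φ` is `C^∞` on `U` then `endValue e φ` is `C^∞` at every `z` with `‖z‖ > R`. [folklore] -/
theorem contDiffAt_endValue {φ : X → ℝ} (hφ : ContMDiffOn (𝓡 3) 𝓘(ℝ, ℝ) ∞ φ (e.U : Set X))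
    {z : E3} (hz : e.R < ‖z‖) : ContDiffAt ℝ ∞ (endValue e φ) z := by
  have h1 : ContMDiffAt (𝓡 3) 𝓘(ℝ, ℝ) ∞ φ (e.dataChartExt z) := by
    rw [e.dataChartExt_of_lt hz]
    exact hφ.contMDiffAt (e.U.isOpen.mem_nhds (e.dataChart_mem ⟨z, hz⟩))
  have h2 : ContMDiffAt 𝓘(ℝ, E3) 𝓘(ℝ, ℝ) ∞ (φ ∘ e.dataChartExt) z :=
    h1.comp z (e.contMDiffAt_dataChartExt hz)
  have h3 : endValue e φ =ᶠ[𝓝 z] φ ∘ e.dataChartExt := by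
    filter_upwards [(isOpen_lt continuous_const continuous_norm).mem_nhds hz] with w hw
    rw [endValue_of_lt e φ hw, Function.comp_apply, e.dataChartExt_of_lt hw]
  exact (contMDiffAt_iff_contDiffAt.1 (h2.congr_of_eventuallyEq h3))

/-- Hence `endValue e φ` is `C¹` on the open shell `{R < ‖z‖}`. [folklore] -/
theorem contDiffOn_endValue {φ : X → ℝ} (hφ : ContMDiffOn (𝓡 3) 𝓘(ℝ, ℝ) ∞ φ (e.U : Set X)) :
    ContDiffOn ℝ 1 (endValue e φ) {z : E3 | e.R < ‖z‖} := fun _ hz ↦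
  ((e.contDiffAt_endValue hφ hz).of_le (by exact_mod_cast le_top)).contDiffWithinAt

end Chart

/-! ### Ends with Schwarzschild chart components: density and slope in the chart -/

section Schwarzschild

variable [IsManifold (𝓡 3) ∞ X] (e : AFEnd X) (D : InitialDataSet (𝓡 3) X)

/-- **The density of the Schwarzschild components is `ψ⁶`**: if `h_{ij}(z) = ψ(z)⁴ δ_{ij}` with
`ψ = 1 + R/‖z‖` then `√(det h_{ij}(z)) = ψ(z)⁶`. Bray 2001, §1 (12). [cite: BrayRPI2001, §1 (12)] -/
theorem sqrt_det_hCoeff_of_eq_schwarzschild {z : E3}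
    (hc : ∀ i j : Fin 3, hCoeff e D z (EuclideanSpace.single i 1) (EuclideanSpace.single j 1) =
      (1 + e.R / ‖z‖) ^ 4 * (if i = j then 1 else 0)) (hψ : 0 < 1 + e.R / ‖z‖) :
    Real.sqrt (Matrix.of fun i j ↦ hCoeff e D z (EuclideanSpace.single i 1)
        (EuclideanSpace.single j 1)).det = (1 + e.R / ‖z‖) ^ 6 := by
  have hmat : (Matrix.of fun i j ↦ hCoeff e D z (EuclideanSpace.single i 1)
      (EuclideanSpace.single j 1)) = (1 + e.R / ‖z‖) ^ 4 • (1 : Matrix (Fin 3) (Fin 3) ℝ) := by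
    ext i j
    rw [Matrix.of_apply, hc i j, Matrix.smul_apply, Matrix.one_apply, smul_eq_mul]
  rw [hmat, Matrix.det_smul, Matrix.det_one, mul_one, Fintype.card_fin,
    show ((1 + e.R / ‖z‖) ^ 4) ^ 3 = ((1 + e.R / ‖z‖) ^ 6) ^ 2 by ring,
    Real.sqrt_sq (by positivity)]

/-- **The slope for the Schwarzschild components is `ψ⁻² ‖∇F‖`**: if `h_{ij}(z) = ψ(z)⁴ δ_{ij}`
at a point `z` of the shell and `φ : X → ℝ` is differentiable at `Φ z`, then
`|∇φ|²_h (Φ z) = ψ(z)⁻⁴ ‖∇(endValue e φ)(z)‖²` (`h^{ij} = ψ⁻⁴ δ^{ij}` in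
`AFEnd.innerDual_mvfderiv_dataChart`). Bray 2001, §1 (12); O'Neill 1983, Ch. 3, p. 60.
[cite: BrayRPI2001, §1 (12)] -/
theorem gradNorm_sq_dataChart_of_eq_schwarzschild [D.metric.HasLeviCivita] {z : E3}
    (hz : e.R < ‖z‖)
    (hc : ∀ i j : Fin 3, hCoeff e D z (EuclideanSpace.single i 1) (EuclideanSpace.single j 1) =
      (1 + e.R / ‖z‖) ^ 4 * (if i = j then 1 else 0)) (hψ : 0 < 1 + e.R / ‖z‖)
    {φ : X → ℝ} (hφ : MDifferentiableAt (𝓡 3) 𝓘(ℝ, ℝ) φ (e.dataChart ⟨z, hz⟩)) :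
    gradNorm D.h φ (e.dataChart ⟨z, hz⟩) ^ 2 =
      ((1 + e.R / ‖z‖) ^ 4)⁻¹ * ‖fderiv ℝ (endValue e φ) z‖ ^ 2 := by
  classical
  set ψ4 : ℝ := (1 + e.R / ‖z‖) ^ 4 with hψ4
  have hψ4ne : ψ4 ≠ 0 := by positivity
  have hmat : (Matrix.of fun i j ↦ hCoeff e D z (EuclideanSpace.single i 1)
      (EuclideanSpace.single j 1)) = ψ4 • (1 : Matrix (Fin 3) (Fin 3) ℝ) := by
    ext i j
    rw [Matrix.of_apply, hc i j, Matrix.smul_apply, Matrix.one_apply, smul_eq_mul]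
  rw [gradNorm_sq_eq_innerDual_mvfderiv]
  change D.metric.innerDual (e.dataChart ⟨z, hz⟩) _ _ = _
  rw [e.innerDual_mvfderiv_dataChart D ⟨z, hz⟩ hφ hφ, hmat, Matrix.inv_smul_one_fin hψ4ne]
  simp only [Matrix.smul_apply, Matrix.one_apply, smul_eq_mul, mul_ite, mul_one, mul_zero,
    ite_mul, zero_mul]
  rw [← sum_sq_apply_single_eq_norm_sq, Finset.mul_sum]
  refine Finset.sum_congr rfl fun l _ ↦ ?_
  rw [Finset.sum_ite_eq' Finset.univ l]
  simp only [Finset.mem_univ, if_true]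
  ring

end Schwarzschild

end AFEnd

/-! ### The capacity is at most the energy over `U` of a test function with `0 < φ₀ < 1` -/

section UpperBound

variable {X : Type} [TopologicalSpace X] [ChartedSpace E3 X] [IsManifold (𝓡 3) ∞ X]
  [T2Space X] [LocallyCompactSpace X] [SigmaCompactSpace X] [MeasurableSpace X] [BorelSpace X]
  (h : ContMDiffRiemannianMetric (𝓡 3) ∞ E3 (TangentSpace (𝓡 3) : X → Type _))
  {e : AFEnd X} {U : Opens X}

/-- **The capacity is at most `(1/2π) ∫_U |∇φ₀|²` for a test function `φ₀` with `0 < φ₀ < 1`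
on `U` and finite energy over `U`.** The double truncations `W_n ∘ φ₀` of
`MassCapacityHarmonic.lean` (`W_n = 0` near `0`, `= 1` near `1`, `|W_n'| ≤ C`, `W_n' → 1` on
`(0, 1)`) are globally smooth test functions supported inside `U`, of energies
`∫_U W_n'(φ₀)² |∇φ₀|² → ∫_U |∇φ₀|²` (dominated convergence); the capacity is at most each of
them. Neither the measure of `∂U` nor `∇φ₀` on `∂U` enters. (Step (C) of
`horizonCapacity_eq_of_harmonic`, which needs no harmonicity.) Bray 2001, §6, Def. 17.
[cite: BrayRPI2001, §6 Def. 17] -/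
theorem horizonCapacity_le_setLIntegral_of_isCapacityTestFn {φ₀ : X → ℝ}
    (hφ₀ : IsCapacityTestFn e U φ₀) (h01 : ∀ x ∈ (U : Set X), 0 < φ₀ x ∧ φ₀ x < 1)
    (hfin : ∫⁻ x in (U : Set X), ENNReal.ofReal (gradNorm h φ₀ x ^ 2) ∂riemannianMeasure h < ⊤) :
    horizonCapacity h e U ≤ ENNReal.ofReal (2 * π)⁻¹ *
      ∫⁻ x in (U : Set X), ENNReal.ofReal (gradNorm h φ₀ x ^ 2) ∂riemannianMeasure h := by
  set μ : Measure X := riemannianMeasure h with hμ_def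
  set g : X → ℝ := fun x ↦ gradNorm h φ₀ x ^ 2 with hg_def
  have hUo : IsOpen (U : Set X) := U.isOpen
  have hUm : MeasurableSet (U : Set X) := hUo.measurableSet
  have h1le : (1 : ℕ∞ω) ≤ ((⊤ : ℕ∞) : ℕ∞ω) := by exact_mod_cast le_top
  have hφ₀1 : ContMDiffOn (𝓡 3) 𝓘(ℝ, ℝ) 1 φ₀ U := hφ₀.contMDiffOn.of_le h1le
  have hφ₀d : ∀ x ∈ (U : Set X), MDifferentiableAt (𝓡 3) 𝓘(ℝ, ℝ) φ₀ x := fun x hx ↦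
    (hφ₀.contMDiffOn.contMDiffAt (hUo.mem_nhds hx)).mdifferentiableAt (by simp)
  -- `g` is continuous and integrable on `U`; `∫⁻_U g = ofReal (∫_U g)`
  have hgc : ContinuousOn g U := by
    have hg' : g = fun x ↦ (ofRiemannian h).innerDual x (mvfderiv (𝓡 3) φ₀ x).toLinearMap
        (mvfderiv (𝓡 3) φ₀ x).toLinearMap :=
      funext fun x ↦ gradNorm_sq_eq_innerDual_mvfderiv h φ₀ x
    rw [hg']
    exact continuousOn_innerDual_mvfderiv h hUo hφ₀1 hφ₀1
  have hg0 : ∀ x, 0 ≤ g x := fun x ↦ sq_nonneg _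
  have hgi : Integrable g (μ.restrict U) :=
    ⟨hgc.aestronglyMeasurable hUm,
      (hasFiniteIntegral_iff_ofReal (Eventually.of_forall hg0)).2 hfin⟩
  have hEU : ∫⁻ x in (U : Set X), ENNReal.ofReal (g x) ∂μ =
      ENNReal.ofReal (∫ x in (U : Set X), g x ∂μ) :=
    (ofReal_integral_eq_lintegral_ofReal hgi (Eventually.of_forall fun x ↦ hg0 x)).symm
  -- the double truncations `W n ∘ φ₀`
  obtain ⟨C, -, δ, W, hδ, hWs, hW0, hW1, hWC, hWev⟩ := exists_doubleTrunc_seq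
  have hWd : ∀ n s, HasDerivAt (W n) (deriv (W n) s) s := fun n s ↦
    (((hWs n).differentiable (by simp)) s).hasDerivAt
  have hWc : ∀ n, Continuous (deriv (W n)) := fun n ↦ (hWs n).continuous_deriv (by simp)
  have hmem := fun n ↦ hφ₀.doubleTrunc_mem (hδ n) (hWs n) (hW0 n) (hW1 n)
  have hψs : ∀ n, ContMDiff (𝓡 3) 𝓘(ℝ, ℝ) ∞ (W n ∘ φ₀) := fun n ↦ (hmem n).1
  have hψU : ∀ n, tsupport (W n ∘ φ₀) ⊆ (U : Set X) := fun n ↦ (hmem n).2.1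
  choose Rn _hRn hψR using fun n ↦ (hmem n).2.2
  -- `|∇(W n ∘ φ₀)|² = W n'(φ₀)² g` on `U`, and `∫_U W n'(φ₀)² g → ∫_U g`
  have hEψ : ∀ n, ∀ x ∈ (U : Set X),
      gradNorm h (W n ∘ φ₀) x ^ 2 = deriv (W n) (φ₀ x) ^ 2 * g x :=
    fun n x hx ↦ gradNorm_sq_real_comp h (hWd n (φ₀ x)) (hφ₀d x hx)
  have hmeas2 : ∀ n, AEStronglyMeasurable (fun x ↦ deriv (W n) (φ₀ x) ^ 2 * g x)
      (μ.restrict U) := fun n ↦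
    (((((hWc n).comp hφ₀.continuous).pow 2).continuousOn).mul hgc).aestronglyMeasurable hUm
  have hlimE : Tendsto (fun n ↦ ∫ x in (U : Set X), deriv (W n) (φ₀ x) ^ 2 * g x ∂μ) atTop
      (𝓝 (∫ x in (U : Set X), g x ∂μ)) := by
    refine tendsto_setIntegral_mul_of_eventually_eq_one hUm hgi hmeas2 (C := C ^ 2)
      (fun n x ↦ ?_) (fun x hx ↦ (hWev _ (h01 x hx).1 (h01 x hx).2).mono fun n hn ↦ by
        rw [hn, one_pow])
    rw [abs_pow]
    exact pow_le_pow_left₀ (abs_nonneg _) (hWC n (φ₀ x)) 2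
  -- the capacity is at most the energy of each truncation
  have hbound : ∀ n, horizonCapacity h e U ≤ ENNReal.ofReal (2 * π)⁻¹ *
      ENNReal.ofReal (∫ x in (U : Set X), deriv (W n) (φ₀ x) ^ 2 * g x ∂μ) := fun n ↦ by
    have h1 := horizonCapacity_le_of_contMDiff h e U (hψs n)
      (fun x hx ↦ image_eq_zero_of_notMem_tsupport fun h' ↦ hx (hψU n h'))
      (tendstoAtEnd_of_eqOn_far (hψR n))
    have hint : Integrable (fun x ↦ deriv (W n) (φ₀ x) ^ 2 * g x) (μ.restrict U) := by
      refine (hgi.norm.const_mul (C ^ 2)).mono' (hmeas2 n) (Eventually.of_forall fun x ↦ ?_)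
      rw [norm_mul, Real.norm_eq_abs, abs_pow]
      exact mul_le_mul_of_nonneg_right (pow_le_pow_left₀ (abs_nonneg _) (hWC n (φ₀ x)) 2)
        (norm_nonneg _)
    have h2 : dirichletEnergy h (W n ∘ φ₀) =
        ENNReal.ofReal (∫ x in (U : Set X), deriv (W n) (φ₀ x) ^ 2 * g x ∂μ) := by
      rw [dirichletEnergy_eq_setLIntegral_of_tsupport_subset h hUm (hψU n),
        ofReal_integral_eq_lintegral_ofReal hint (Eventually.of_forall fun x ↦
          mul_nonneg (sq_nonneg _) (hg0 x))]
      exact setLIntegral_congr_fun hUm fun x hx ↦ by rw [hEψ n x hx]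
    rwa [h2] at h1
  have hl := ENNReal.Tendsto.const_mul (ENNReal.tendsto_ofReal hlimE)
    (Or.inr ENNReal.ofReal_ne_top) (a := ENNReal.ofReal (2 * π)⁻¹)
  rw [← hEU] at hl
  exact ge_of_tendsto' hl hbound

end UpperBound

/-! ### Bray's Green's function of the end, through the coordinate function -/

namespace AFEnd

section Green

variable {X : Type} [TopologicalSpace X] [ChartedSpace E3 X] (e : AFEnd X)

/-- **Bray's Green's function read through the coordinates is a test function.** On an end
`e` (of inner radius `R`), `φ₀ = greenProfile R ∘ coord`,
`x ↦ max (0, (‖coord x‖ - R)/(‖coord x‖ + R))` — the Schwarzschild Green's function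
`(1 - m/2r)/(1 + m/2r)` of (86) for `R = m/2`, and `0` off the end, where `coord = 0` — is
continuous on `X` (across `∂U`: near a point off the end, end
points have coordinates close to the sphere, `eventually_norm_coord_lt`), smooth on `U = e.U`,
zero off `U`, and tends to `1` at infinity. Bray 2001, §6, (86) with (12).
[cite: BrayRPI2001, §6 Def. 17 (86), with (12)] -/
theorem isCapacityTestFn_greenProfile_coord :
    IsCapacityTestFn e e.U (fun x ↦ greenProfile e.R (e.coord x)) := by
  have hR : 0 < e.R := e.R_pos
  have hoff : ∀ x, x ∉ (e.U : Set X) → greenProfile e.R (e.coord x) = 0 := fun x hx ↦ by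
    rw [e.coord_of_not_mem hx]
    exact greenProfile_eq_zero_of_le hR (by rw [norm_zero]; exact hR.le)
  refine ⟨?_, ?_, hoff, ?_⟩
  · rw [continuous_iff_continuousAt]
    intro x
    by_cases hx : x ∈ e.U
    · exact (continuous_greenProfile hR).continuousAt.comp (e.contMDiffAt_coord hx).continuousAt
    · rw [ContinuousAt, hoff x hx, Metric.tendsto_nhds]
      intro ε hε
      have hR' : e.R < e.R + ε * e.R := lt_add_of_pos_right _ (by positivity)
      filter_upwards [e.eventually_norm_coord_lt hx hR'] with y hy
      by_cases hyU : y ∈ e.U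
      · have hlt := hy hyU
        have hgt := e.lt_norm_coord hyU
        rw [greenProfile_eq_of_lt hR hgt, Real.dist_eq, sub_zero,
          abs_of_nonneg (div_nonneg (by linarith) (by positivity)), div_lt_iff₀ (by positivity)]
        nlinarith
      · rw [hoff y hyU, dist_self]
        exact hε
  · intro y hy
    have hgt := e.lt_norm_coord hy
    exact ((contDiffAt_greenProfile hR hgt).contMDiffAt.comp y
      (e.contMDiffAt_coord hy)).contMDiffWithinAt
  · refine (tendsto_greenProfile hR).congr' ?_
    filter_upwards [eventually_cobounded_le_norm (E := E3) (e.R + 1)] with z hz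
    have hz' : e.R < ‖z‖ := by linarith
    rw [endValue_of_lt e _ hz', e.coord_dataChart]

/-- The Green's function lies strictly between `0` and `1` on the end. [folklore] -/
theorem greenProfile_coord_mem_Ioo {x : X} (hx : x ∈ e.U) :
    0 < greenProfile e.R (e.coord x) ∧ greenProfile e.R (e.coord x) < 1 := by
  have hR : 0 < e.R := e.R_pos
  have hgt := e.lt_norm_coord hx
  rw [greenProfile_eq_of_lt hR hgt]
  exact ⟨div_pos (by linarith) (by positivity), (div_lt_one (by positivity)).2 (by linarith)⟩

end Green

end AFEnd

/-! ### The capacity of an end with Schwarzschild chart components -/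

namespace AFEnd

variable {X : Type} [TopologicalSpace X] [ChartedSpace E3 X] [IsManifold (𝓡 3) ∞ X]
  [T2Space X] [LocallyCompactSpace X] [MeasurableSpace X] [BorelSpace X]
  (e : AFEnd X) (D : InitialDataSet (𝓡 3) X) [D.metric.HasLeviCivita]

/-- **Lower bound: every test function has energy at least `8πR`** on an end with
Schwarzschild chart components `h_{ij} = (1 + R/‖z‖)⁴ δ_{ij}` (`R = e.R`) whose end `U = e.U` is
an exterior region: `∫_X |∇φ|²_h dV_h ≥ ∫_U |∇φ|²_h dV_h = ∫_{‖z‖ > R} ψ² ‖∇F‖² dz ≥ 8πR` with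
`F = endValue e φ` (continuous at the sphere `‖z‖ = R`, `C¹` on the shell, `0` on the sphere,
`→ 1` at infinity; `SchwarzschildCapacity.le_lintegral_shell_conformalGradSq`). With `R = m/2`
this is `4πm`. Bray 2001, §6, Def. 17 and Thm. 9 (case of equality), for the metric (12).
[cite: BrayRPI2001, §6 Def. 17 and Thm. 9, with (12)] -/
theorem le_dirichletEnergy_of_hCoeff_eq_schwarzschild (hU : IsExteriorRegion e e.U)
    (hc : ∀ z : E3, e.R < ‖z‖ → ∀ i j : Fin 3,
      hCoeff e D z (EuclideanSpace.single i 1) (EuclideanSpace.single j 1) =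
        (1 + e.R / ‖z‖) ^ 4 * (if i = j then 1 else 0))
    {φ : X → ℝ} (hφ : IsCapacityTestFn e e.U φ) :
    ENNReal.ofReal (8 * π * e.R) ≤ dirichletEnergy D.h φ := by
  obtain ⟨hcont, hdiff, hzero, hlim⟩ := hφ
  have hR : 0 < e.R := e.R_pos
  -- the hypotheses of the shell estimate for `F = endValue e φ`
  have h1 : ∀ x : E3, ‖x‖ = e.R → ContinuousAt (endValue e φ) x := fun x hx ↦
    e.continuousAt_endValue_of_norm_eq hU hcont hzero hx
  have h2 : ContDiffOn ℝ 1 (endValue e φ) {x : E3 | e.R < ‖x‖} := e.contDiffOn_endValue hdiff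
  have h3 : ∀ x : E3, ‖x‖ = e.R → endValue e φ x = 0 := fun x hx ↦
    endValue_of_not_lt e φ (by rw [hx]; exact lt_irrefl _)
  have hII := le_lintegral_shell_conformalGradSq hR h1 h2 h3 hlim
  refine hII.trans ?_
  have hfar := e.setLIntegral_far D (fun p ↦ ENNReal.ofReal (gradNorm D.h φ p ^ 2)) le_rfl
  rw [e.far_radius_eq] at hfar
  simp only [dirichletEnergy]
  calc ∫⁻ x in {x : E3 | e.R < ‖x‖},
        ENNReal.ofReal ((1 + e.R / ‖x‖) ^ 2 * ‖fderiv ℝ (endValue e φ) x‖ ^ 2)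
      = ∫⁻ z in {z : E3 | e.R < ‖z‖}, ENNReal.ofReal (gradNorm D.h φ (e.dataChartExt z) ^ 2) *
          ENNReal.ofReal (Real.sqrt (Matrix.of fun i j ↦ hCoeff e D z
            (EuclideanSpace.single i 1) (EuclideanSpace.single j 1)).det) := by
        refine setLIntegral_congr_fun (isOpen_lt continuous_const continuous_norm).measurableSet
          fun z hz ↦ ?_
        have hz' : e.R < ‖z‖ := hz
        have hz0 : 0 < ‖z‖ := hR.trans hz'
        have hψ : 0 < 1 + e.R / ‖z‖ := by positivity
        have hφd : MDifferentiableAt (𝓡 3) 𝓘(ℝ, ℝ) φ (e.dataChart ⟨z, hz'⟩) :=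
          (hdiff.contMDiffAt (e.U.isOpen.mem_nhds (e.dataChart_mem _))).mdifferentiableAt
            (by simp)
        rw [e.dataChartExt_of_lt hz', e.sqrt_det_hCoeff_of_eq_schwarzschild D (hc z hz') hψ,
          e.gradNorm_sq_dataChart_of_eq_schwarzschild D hz' (hc z hz') hψ hφd,
          ← ENNReal.ofReal_mul (by positivity)]
        congr 1
        field_simp
    _ = ∫⁻ p in (e.U : Set X), ENNReal.ofReal (gradNorm D.h φ p ^ 2) ∂riemannianMeasure D.h :=
        hfar.symm
    _ ≤ _ := setLIntegral_le_lintegral _ _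

/-- **The energy over `U` of the Green's function is at most `8πR`** for Schwarzschild chart
components:
`∫_U |∇φ₀|²_h dV_h = ∫_{‖z‖ > R} ψ² ‖∇((r - R)/(r + R))‖² dz ≤ ∫ 4R²/(r²(r + R)²) dz = 8πR`
(it equals `8πR = 4πm`). Bray 2001, §6, (85)–(87) for the metric (12).
[cite: BrayRPI2001, §6 Def. 17 (85)–(87), with (12)] -/
theorem setLIntegral_gradNorm_sq_greenProfile_coord_le
    (hc : ∀ z : E3, e.R < ‖z‖ → ∀ i j : Fin 3,
      hCoeff e D z (EuclideanSpace.single i 1) (EuclideanSpace.single j 1) =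
        (1 + e.R / ‖z‖) ^ 4 * (if i = j then 1 else 0)) :
    ∫⁻ x in (e.U : Set X),
        ENNReal.ofReal (gradNorm D.h (fun x ↦ greenProfile e.R (e.coord x)) x ^ 2)
        ∂riemannianMeasure D.h ≤ ENNReal.ofReal (8 * π * e.R) := by
  have hR : 0 < e.R := e.R_pos
  set φ₀ : X → ℝ := fun x ↦ greenProfile e.R (e.coord x) with hφ₀
  have hdiff := (e.isCapacityTestFn_greenProfile_coord).contMDiffOn
  rw [← e.far_radius_eq, e.setLIntegral_far D _ le_rfl]
  refine (setLIntegral_mono' (isOpen_lt continuous_const continuous_norm).measurableSet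
    fun z hz ↦ ?_).trans (lintegral_shell_profile_le hR)
  have hz' : e.R < ‖z‖ := hz
  have hz0 : 0 < ‖z‖ := hR.trans hz'
  have hψ : 0 < 1 + e.R / ‖z‖ := by positivity
  have hφd : MDifferentiableAt (𝓡 3) 𝓘(ℝ, ℝ) φ₀ (e.dataChart ⟨z, hz'⟩) :=
    (hdiff.contMDiffAt (e.U.isOpen.mem_nhds (e.dataChart_mem _))).mdifferentiableAt (by simp)
  -- in the chart the Green's function is the profile
  have hev : endValue e φ₀ =ᶠ[𝓝 z] greenProfile e.R := by
    filter_upwards [(isOpen_lt continuous_const continuous_norm).mem_nhds hz'] with w hw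
    rw [endValue_of_lt e _ hw, hφ₀]
    dsimp only
    rw [e.coord_dataChart]
  have hbd := norm_fderiv_greenProfile_le hR hz' hev
  rw [e.dataChartExt_of_lt hz', e.sqrt_det_hCoeff_of_eq_schwarzschild D (hc z hz') hψ,
    e.gradNorm_sq_dataChart_of_eq_schwarzschild D hz' (hc z hz') hψ hφd,
    ← ENNReal.ofReal_mul (by positivity)]
  apply ENNReal.ofReal_le_ofReal
  calc ((1 + e.R / ‖z‖) ^ 4)⁻¹ * ‖fderiv ℝ (endValue e φ₀) z‖ ^ 2 * (1 + e.R / ‖z‖) ^ 6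
      = (1 + e.R / ‖z‖) ^ 2 * ‖fderiv ℝ (endValue e φ₀) z‖ ^ 2 := by field_simp
    _ ≤ (1 + e.R / ‖z‖) ^ 2 * (2 * e.R / (‖z‖ + e.R) ^ 2) ^ 2 := by gcongr
    _ = 4 * e.R ^ 2 / (‖z‖ ^ 2 * (‖z‖ + e.R) ^ 2) := by
        field_simp
        ring

/-- **The capacity of the horizon of an end isometric to the Schwarzschild exterior is
`2m = 4R`.** Let the end `e` of the `3`-manifold `(X, h)`, of inner radius `R`, have the
Schwarzschild chart components `h_{ij}(z) = (1 + R/‖z‖)⁴ δ_{ij}` for `‖z‖ > R` — i.e. let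
`U = e.U` be isometric, by the chart, to the Schwarzschild exterior `({r > m/2}, (1 + m/2r)⁴ δ)`
of mass `m = 2R` — and let `U` be an exterior region of `e` (connected, compact modulo the end,
so that the horizon `r = m/2` is present in `X` as `∂U`). Then the capacity of Def. 17 of the
horizon `∂U` with outside `U` is `ℰ(∂U, h) = 2m`: `horizonCapacity D.h e e.U = ENNReal.ofReal (4R)`.
Bray, J. Differential Geom. 59 (2001), Thm. 9, case of equality (*"`m = ½ ℰ(Σ, g)` if and only
if `(M³, g)` is isometric to a Schwarzschild metric of mass `m` outside `Σ`"*, direction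
Schwarzschild ⇒ equality), with Def. 17 and (86)–(87) for (12); the model computation
`Schwarzschild.horizonCapacity_timeSymmetricData` is the case of the tautological end of the
punctured slice. Upper bound: the Green's function `(r - R)/(r + R) ∘ coord`
(`isCapacityTestFn_greenProfile_coord`, `setLIntegral_gradNorm_sq_greenProfile_coord_le`,
`horizonCapacity_le_setLIntegral_of_isCapacityTestFn`); lower bound:
`le_dirichletEnergy_of_hCoeff_eq_schwarzschild`.
[cite: BrayRPI2001, §6 Thm. 9 (case of equality) and Def. 17 (85)–(87), with (12)] -/
theorem horizonCapacity_eq_of_hCoeff_eq_schwarzschild [SigmaCompactSpace X]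
    (hU : IsExteriorRegion e e.U)
    (hc : ∀ z : E3, e.R < ‖z‖ → ∀ i j : Fin 3,
      hCoeff e D z (EuclideanSpace.single i 1) (EuclideanSpace.single j 1) =
        (1 + e.R / ‖z‖) ^ 4 * (if i = j then 1 else 0)) :
    horizonCapacity D.h e e.U = ENNReal.ofReal (4 * e.R) := by
  have hR : 0 < e.R := e.R_pos
  have h2π : ENNReal.ofReal (2 * π)⁻¹ * ENNReal.ofReal (8 * π * e.R) =
      ENNReal.ofReal (4 * e.R) := by
    rw [← ENNReal.ofReal_mul (by positivity)]
    congr 1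
    field_simp
    ring
  apply le_antisymm
  · have hE := e.setLIntegral_gradNorm_sq_greenProfile_coord_le D hc
    calc horizonCapacity D.h e e.U
        ≤ ENNReal.ofReal (2 * π)⁻¹ * ∫⁻ x in (e.U : Set X), ENNReal.ofReal
            (gradNorm D.h (fun x ↦ greenProfile e.R (e.coord x)) x ^ 2) ∂riemannianMeasure D.h :=
          horizonCapacity_le_setLIntegral_of_isCapacityTestFn D.h
            e.isCapacityTestFn_greenProfile_coord (fun x hx ↦ e.greenProfile_coord_mem_Ioo hx)
            (hE.trans_lt ENNReal.ofReal_lt_top)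
      _ ≤ ENNReal.ofReal (2 * π)⁻¹ * ENNReal.ofReal (8 * π * e.R) := by gcongr
      _ = ENNReal.ofReal (4 * e.R) := h2π
  · refine le_iInf₂ fun φ hφ ↦ ?_
    calc ENNReal.ofReal (4 * e.R)
        = ENNReal.ofReal (2 * π)⁻¹ * ENNReal.ofReal (8 * π * e.R) := h2π.symm
      _ ≤ ENNReal.ofReal (2 * π)⁻¹ * dirichletEnergy D.h φ := by
          gcongr
          exact e.le_dirichletEnergy_of_hCoeff_eq_schwarzschild D hU hc hφ

/-- **`ℰ(∂U, h)/2 = m`** for an end with the Schwarzschild chart components of mass `m = 2R` —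
the conclusion `(horizonCapacity …).toReal / 2 = m` of `Bray2001_capacity_eq_of_penrose_eq` for
an exterior region recognised as the Schwarzschild exterior. Bray 2001, Thm. 9 (case of
equality). [cite: BrayRPI2001, §6 Thm. 9 (case of equality)] -/
theorem horizonCapacity_toReal_div_two_eq_of_hCoeff_eq_schwarzschild [SigmaCompactSpace X]
    (hU : IsExteriorRegion e e.U)
    (hc : ∀ z : E3, e.R < ‖z‖ → ∀ i j : Fin 3,
      hCoeff e D z (EuclideanSpace.single i 1) (EuclideanSpace.single j 1) =
        (1 + e.R / ‖z‖) ^ 4 * (if i = j then 1 else 0)) :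
    (horizonCapacity D.h e e.U).toReal / 2 = 2 * e.R := by
  rw [e.horizonCapacity_eq_of_hCoeff_eq_schwarzschild D hU hc,
    ENNReal.toReal_ofReal (by linarith [e.R_pos])]
  ring

end AFEnd

end Literature.Geometry.Lorentzian

end
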